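import Summits.Ventures.DiscreteObjects.Hadamard.PrimeCubeOrder7
import Summits.Ventures.DiscreteObjects.Hadamard.ElemAbelianRank2Small

/-!
# Hadamard 668 census, family F12 — no signed automorphism of an H(668) of order divisible by `125 = 5³` (kernel)

Framing: lottery ticket; floor = certified bounds/negative ranges.

Cell pub-namedobj (venture DiscreteObjects), target (H), hadamard gen 18.  The gen-17 argument for `7³` (`PrimeCubeOrder7`)
works verbatim for `5³`: **`hadamard668_signedAut_not_dvd_orderOf_125`** — `5³ ∤ orderOf (π, κ)` for every signed
automorphism `(π, κ, d, e)` of a Hadamard matrix of order `668`.  PROOF.  A power has pair-order exactly `125`; its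
`25`-th power `(ρ, τ)` has `ρ⁵ = τ⁵ = 1` and `ρ ≠ 1` (`signedAut_snd_eq_one` if only `τ ≠ 1`), so `ρ` fixes
`f ∈ [8, 108]` rows with `f ≡ 8 (mod 10)` (`census5`); but the rows moved by `ρ = π'^25` carry a free action of
`⟨π'⟩ ≅ ℤ/125` (`prime_pow_dvd_card_moved`), so `125 ∣ 668 − f ∈ [560, 660]`, i.e. `f = 43` — not `≡ 8 (mod 10)`.
With gen 18's order-25 structure (`Order25FixedEight668`): the `5`-part of the order of any signed automorphism of an
H(668) divides `25`, and an element of order `25` fixes exactly `8 + 8` (its fifth power `68 + 68`).  Order `25`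
itself and `C₅ × C₅` remain open.  Ours, not literature; no `sorry`, no definitions.
-/

namespace Summit.Ventures.DiscreteObjects.Hadamard

open Finset BigOperators Matrix

open Literature.Combinatorics.Designs.GoethalsSeidel (IsHadamardMatrix)

variable {ι : Type*} [Fintype ι] [DecidableEq ι]

section main
variable {H : Matrix ι ι ℤ}

/-- **No signed automorphism of an H(668) whose permutation pair has order divisible by `125 = 5³`.** -/
theorem hadamard668_signedAut_not_dvd_orderOf_125 (hH : IsHadamardMatrix H) (hι : Fintype.card ι = 668)
    (π κ : Equiv.Perm ι) (d e : ι → ℤ) (haut : IsSignedAut H π κ d e)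
    (hdvd : 5 ^ 3 ∣ orderOf ((π, κ) : Equiv.Perm ι × Equiv.Perm ι)) : False := by
  have hcard : (Fintype.card ι : ℤ) ≠ 0 := by rw [hι]; norm_num
  -- a power of pair-order exactly 125
  set x : Equiv.Perm ι × Equiv.Perm ι := (π, κ) with hx
  have hx0 : orderOf x ≠ 0 := (orderOf_pos x).ne'
  set k := orderOf x / 5 ^ 3 with hk
  have hord : orderOf (x ^ k) = 5 ^ 3 := orderOf_pow_orderOf_div hx0 hdvd
  have hxk : x ^ k = ((π ^ k, κ ^ k) : Equiv.Perm ι × Equiv.Perm ι) := by rw [hx, Prod.pow_mk]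
  rw [hxk] at hord
  obtain ⟨h1, h2, h3⟩ := pow_data_of_orderOf hord (a := 5 ^ 2) (by norm_num) (by norm_num)
  have haut' := isSignedAut_pow haut k
  -- the 25-th power (ρ, τ): exponent 5, ρ ≠ 1
  have haut25 := isSignedAut_pow haut' (5 ^ 2)
  have hρ5 : ((π ^ k) ^ 5 ^ 2) ^ 5 = 1 := by rw [← pow_mul]; exact h1
  have hτ5 : ((κ ^ k) ^ 5 ^ 2) ^ 5 = 1 := by rw [← pow_mul]; exact h2
  have hρne : (π ^ k) ^ 5 ^ 2 ≠ 1 := by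
    rcases h3 with h | h
    · exact h
    · intro hρ
      apply h
      rw [hρ] at haut25
      exact signedAut_snd_eq_one H hH hcard haut25 (by decide : Odd 5) hτ5
  -- census: 8 ≤ f ≤ 108, f ≡ 8 (mod 10) rows fixed by ρ
  obtain ⟨-, hR1, hR2, hRm⟩ := census5 hH hι haut25 hρ5 hτ5 hρne
  -- 125 divides the number of rows moved by ρ = (π^k)^(5^2)
  have hdvd' := prime_pow_dvd_card_moved (π ^ k) (k := 2) (by norm_num : (5 : ℕ).Prime) h1
  have hsplit := Finset.card_filter_add_card_filter_not (s := (univ : Finset ι))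
    (fun i => ((π ^ k) ^ 5 ^ 2) i = i)
  rw [Finset.card_univ, hι] at hsplit
  have e : (univ.filter fun i => ((π ^ k) ^ 5 ^ 2) i ≠ i) = univ.filter fun i => ¬ ((π ^ k) ^ 5 ^ 2) i = i := rfl
  rw [e] at hdvd'
  obtain ⟨c, hc⟩ := hdvd'
  rw [show (5 : ℕ) ^ 3 = 125 from rfl] at hc
  omega

/-- **The `5`-part of the order of a signed automorphism of an H(668) divides `25`**: `π^(5^k) = κ^(5^k) = 1` implies
`π^25 = κ^25 = 1`. -/
theorem hadamard668_signedAut_pow25_eq_one (hH : IsHadamardMatrix H) (hι : Fintype.card ι = 668)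
    (π κ : Equiv.Perm ι) (d e : ι → ℤ) (haut : IsSignedAut H π κ d e) {k : ℕ}
    (hπ : π ^ 5 ^ k = 1) (hκ : κ ^ 5 ^ k = 1) : π ^ 25 = 1 ∧ κ ^ 25 = 1 := by
  set x : Equiv.Perm ι × Equiv.Perm ι := (π, κ) with hx
  have hxk : x ^ 5 ^ k = 1 := by rw [hx, Prod.pow_mk, hπ, hκ]; rfl
  have hord : orderOf x ∣ 5 ^ k := orderOf_dvd_of_pow_eq_one hxk
  obtain ⟨i, hi, horder⟩ := (Nat.dvd_prime_pow (by norm_num : (5 : ℕ).Prime)).1 hord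
  have hi2 : i ≤ 2 := by
    by_contra hi3
    have h125 : 5 ^ 3 ∣ orderOf x := by
      rw [horder]
      exact pow_dvd_pow 5 (by omega)
    exact hadamard668_signedAut_not_dvd_orderOf_125 hH hι π κ d e haut h125
  have h25 : x ^ 25 = 1 := by
    have hdvd25 : orderOf x ∣ 25 := by
      rw [horder, show (25 : ℕ) = 5 ^ 2 by norm_num]
      exact pow_dvd_pow 5 hi2
    exact orderOf_dvd_iff_pow_eq_one.mp hdvd25
  rw [hx, Prod.pow_mk, Prod.mk_eq_one] at h25
  exact h25

end main

end Summit.Ventures.DiscreteObjects.Hadamard
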